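import Literature.MathematicalPhysics.QuantumFieldTheory.Balaban1983to89.Node00.TorusCoverGaugeTokensRFloor
import Literature.MathematicalPhysics.QuantumFieldTheory.Balaban1983to89.Node00.CriticalOnFibreTopGuarded

/-!
# NODE 00 — GUARD-GENERIC twins of the K0 road's (9)-STEP TOKENS: `Gauge9RegSepTopStepG ∕ Gauge9RegSepTopStepR10G F N Sup (M : ℕ) (Adm : StepGuard F) …` — FILE 29 ∕ 34c's
# floor-carrying tokens with the binder `c ≤ ν.M₁` replaced by an ARBITRARY prefix predicate `Adm ν M g K k s` (module 47's currency), the (9)-reductions from the GUARDED stub-1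
# fact `Prop8RegSepTopStepG … Adm …` (module 48's proofs with `hadm` threaded; the (152) token keeps its floor, which joins the guard by conjunction), and 36c's print-cube forms

Cell `pub-ymgap` (HUMAN RULINGS D-0062 ∕ D-0088), seat `pub-ymgap-dag-n07-e` g20 (R141 (C) row s3 lineage; DAG node N07 = [B11]; lane owner; declarer of FILE 29 ∕ 34c ∕ 36c ∕ 46–50), 2026-08-28.
`--kind definition --supports stmt-QuantumFields-20541` (K0⁷; count-neutral).  The (9)-side of the GUARDED chain (LOCATED-STUB1-FLOOR census item (c7): if the plan's V20 names the
two-part guard `floorGuard F c ⊓ levelGuard`, every consumer re-keys in G-form).  Additive — FILE 29 ∕ 34c ∕ 36c ∕ 48 are NOT edited.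

THE PRINT.  [B11] = T. Bałaban, CMP **102** (1985) 277–309 `[Balaban1985Variational]`: Thm 1 (8)–(10) p. 279, Sect. F pp. 300–305 ((144) collared cubes, (152) the gauge on them,
p. 304 lines 1–2 «R₁M₁ sufficiently big»); [6] = CMP **99** (1985) `[Balaban1985RegularSpaces]` Prop. 6 p. 99, (1.3)–(1.6) p. 77; [I] = CMP **109** (1987) `[Balaban1987RG1]` (0.1) p. 251
(the torus `T_η`, where the Sect. F windows of an actual run do not wrap).  Print states (9)–(10) for the numerics AND steps of the construction; a guard `Adm` is how the tree says so.

WHAT IS PROVED (sorry-free; TWO definitions (named facts, `Prop`s, never asserted); axioms standard).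
* §1 `Gauge9RegSepTopStepG F N Sup M Adm B₃ B₃' a₀ a₁` (FILE 29's `…R` with `Adm ν M g K k s` for `c ≤ ν.M₁`), `Gauge9RegSepTopStepR10G …` (34c's four-letter token likewise);
  `…R_iff_G_floorGuard` ×2 (`Iff.rfl`), `.of_le`, `.of_imp` (antitone in the guard), `….toG_of_imp_floor` ∕ `….toR_of_floor_imp`, `Gauge9RegSepTopStepR10G.toG` (forget the second-order letter).
* §2 ★ `gauge9G_of_prop8TopStepG_of_gauge152R` ∕ ★ `gauge9R10G_of_prop8TopStepG_of_gauge152R10`: `h8 : Prop8RegSepTopStepG Sup Adm`, the (152) token at floor `c` ⟹ the (9)-token under the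
  guard `Adm ⊓ floorGuard c` (module 48's proofs; `h8` applied with `hadm.1`, `h152` with `hadm.2`); the `_of_imp` forms for a guard that IMPLIES the floor.
* §3 ★★ `gauge9GP_of_prop8TopStepG_of_prop6P_of_one_le` ∕ ★★ `gauge9R10GP_of_prop8TopStepG_of_prop6P_of_one_le` — 36c's K0-road suppliers with stub 1 GUARDED: guard
  `Adm ⊓ floorGuard ((11·4 + 4·(ρ₀L))·L)`, constants `b9OfP·B₃`, `a0OfP` unchanged.
NOT HERE: the guarded gauge sentence `VariationalThm1GaugeRegSepTop7MG` and node00-def-K0a's row lemmas with `hadm` (typed only on the plan's two-guard word), the V20 texts (plan).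
HONEST SCOPE.  Definitions of named facts + binder-threading bookkeeping BY NAME; nothing of [B11] ∕ [6] asserted; antecedents OPEN, inhabited nowhere; `stub_prop8StepCoP13` ∕ K0⁷ NOT
closed; N07 NOT discharged; counts unmoved (28∕28 · 5∕27); one finite 𝕋⁴ programme at fixed ε — the route closes the conditional finite-𝕋⁴ rung `BalabanLadder.UV` only; nothing
continuum ∕ ℝ⁴ ∕ OS ∕ mass gap ∕ Clay.  No `sorry`, no `instance`, no `notation`.
-/

noncomputable section

namespace Literature.MathematicalPhysics.QuantumFieldTheory.Balaban1983to89.Node00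

open scoped Matrix.Norms.L2Operator
open T4Continuum (T4Family)
open B15DeterminingSets B12RegularSpaces111
open B8LeafModelZd (ZdIdx)

/-! ## §1  The guard-generic (9)-tokens -/

section TokensG

variable (F : T4Family) (N : ℕ) [NeZero N]

/-- **[B11] THM 1 (9) LINE 1 FOR CRITICAL CONFIGURATIONS, GUARD-GENERIC** (FILE 29's `Gauge9RegSepTopStepR` with the binder `Adm ν M g K k s` in place of `c ≤ ν.M₁`): on every
non-wrapping grid cube of the two families inside `Ω_n`, an `SU(N)` gauge and a potential with (9)'s first two letters at `B₃'·δ_n`.  A `Prop`, NEVER asserted.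
[cite: Balaban1985Variational, Thm 1 (9) p.279, (144)–(152) pp.300–301, p.304 lines 1–2; Balaban1985RegularSpaces, (1.3)–(1.6) p.77; Balaban1987RG1, (0.1) p.251] -/
def Gauge9RegSepTopStepG (Sup : (ν : Stage7Numerics) → (K : ℕ) → (ℕ → Set (Site (F.P K) 0)) → Set (Site (F.P K) 0)) (M : ℕ) (Adm : StepGuard F)
    (B₃ B₃' a₀ a₁ : ℝ) : Prop :=
  ∀ (ν : Stage7Numerics) (g : ℕ → ℝ) (K k : ℕ) (s : SeqOfRecord F ν M g K k), Sect2.SeqSeparated ν.M₁ s → 0 < ν.M₁ → Adm ν M g K k s → 1 ≤ k →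
    ∀ (ε₀ : ℝ) (δ : ℕ → ℝ),
    (∀ n, n ≤ k → 0 < δ n ∧ δ n ≤ a₁ ∧ B₃ * δ n ≤ ε₀) → (∀ n, n < k → δ n ≤ 2 * δ (n + 1)) → (∀ n, n < k → δ (n + 1) ≤ 2 * δ n) → ε₀ ≤ a₀ →
    ∀ W : MSField (F.P K) (SU N), Sect2.DataSmall7PTop (avOfRecord F N K) s.Ω (Sup ν K s.Ω) k δ W →
      ∀ U : GaugeField (F.P K) 0 (SU N),
        (∀ n, n ≤ k → PlaqSmallOn (Sect2.omegaPlaqsTop s.Ω (Sup ν K s.Ω) n) (ε₀ * (F.P K).eta n ^ 2) U) →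
        Sect2.CoDivClassOnTop s.Ω (Sup ν K s.Ω) k ε₀ U → AgreeOn (genSet s.Ω k) (avgFamily (avOfRecord F N K) U) W →
        IsCritOnFibre F N K (genSet s.Ω k) W U →
        ∀ n, 1 ≤ n → n ≤ k → ∀ S : ℕ,
          (S = B14.Eq213MaximalDomains.side (F.P K).L M n ∨ S = B14.Eq213MaximalDomains.side (F.P K).L M (n + 1)) → (S : ℤ) < (F.P K).sitesPerDir 0 →
          ∀ a ∈ cubeIndices (F.P K) S, cubeEnl (F.P K) S a 0 ⊆ s.Ω n →
            ∃ u : GaugeTransf (F.P K) 0 (SU N), ∃ A : PBond (F.P K) 0 → MatA N,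
              (∀ b ∈ (Sect2.regionOfSet (F.P K) (cubeEnl (F.P K) S a 0)).bonds,
                gaugeU (fun x => ιSU N (u x)) (fun b' => ιSU N (U b')) b = expI ((F.P K).eta n) (A b)) ∧
              (∀ b ∈ (Sect2.regionOfSet (F.P K) (cubeEnl (F.P K) S a 0)).bonds, ‖A b‖ < B₃' * δ n) ∧
              ∀ q ∈ (Sect2.regionOfSet (F.P K) (cubeEnl (F.P K) S a 0)).dpairs,
                ‖grad ((F.P K).eta n) q.2.1 (fun y => A ⟨y, q.2.2⟩) q.1‖ < B₃' * δ n

/-- **[B11] THM 1 (9)–(10) FOR CRITICAL CONFIGURATIONS WITH THE SECOND-ORDER LETTER, GUARD-GENERIC** (34c's `Gauge9RegSepTopStepR10` with `Adm ν M g K k s` for `c ≤ ν.M₁`).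
A `Prop`, NEVER asserted. [cite: Balaban1985Variational, Thm 1 (9)–(10) p.279, Sect. F pp.300–305; Balaban1985RegularSpaces, (1.3)–(1.6) p.77; Balaban1987RG1, (0.1) p.251] -/
def Gauge9RegSepTopStepR10G (Sup : (ν : Stage7Numerics) → (K : ℕ) → (ℕ → Set (Site (F.P K) 0)) → Set (Site (F.P K) 0)) (M : ℕ) (Adm : StepGuard F)
    (B₃ B₃' a₀ a₁ : ℝ) : Prop :=
  ∀ (ν : Stage7Numerics) (g : ℕ → ℝ) (K k : ℕ) (s : SeqOfRecord F ν M g K k), Sect2.SeqSeparated ν.M₁ s → 0 < ν.M₁ → Adm ν M g K k s → 1 ≤ k →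
    ∀ (ε₀ : ℝ) (δ : ℕ → ℝ),
    (∀ n, n ≤ k → 0 < δ n ∧ δ n ≤ a₁ ∧ B₃ * δ n ≤ ε₀) → (∀ n, n < k → δ n ≤ 2 * δ (n + 1)) → (∀ n, n < k → δ (n + 1) ≤ 2 * δ n) → ε₀ ≤ a₀ →
    ∀ W : MSField (F.P K) (SU N), Sect2.DataSmall7PTop (avOfRecord F N K) s.Ω (Sup ν K s.Ω) k δ W →
      ∀ U : GaugeField (F.P K) 0 (SU N),
        (∀ n, n ≤ k → PlaqSmallOn (Sect2.omegaPlaqsTop s.Ω (Sup ν K s.Ω) n) (ε₀ * (F.P K).eta n ^ 2) U) →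
        Sect2.CoDivClassOnTop s.Ω (Sup ν K s.Ω) k ε₀ U → AgreeOn (genSet s.Ω k) (avgFamily (avOfRecord F N K) U) W →
        IsCritOnFibre F N K (genSet s.Ω k) W U →
        ∀ n, 1 ≤ n → n ≤ k → ∀ S : ℕ,
          (S = B14.Eq213MaximalDomains.side (F.P K).L M n ∨ S = B14.Eq213MaximalDomains.side (F.P K).L M (n + 1)) → (S : ℤ) < (F.P K).sitesPerDir 0 →
          ∀ a ∈ cubeIndices (F.P K) S, cubeEnl (F.P K) S a 0 ⊆ s.Ω n →
            Sect2.LocalGauge10On (cubeEnl (F.P K) S a 0) ((F.P K).eta n) (B₃' * δ n) U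

variable {F N}

/-- FILE 29's floor-carrying token IS the instance `Adm := floorGuard F c`. [cite: Balaban1985RegularSpaces, (1.3)–(1.6) p.77 (bookkeeping)] -/
theorem gauge9RegSepTopStepR_iff_G_floorGuard {Sup : (ν : Stage7Numerics) → (K : ℕ) → (ℕ → Set (Site (F.P K) 0)) → Set (Site (F.P K) 0)} {M c : ℕ} {B₃ B₃' a₀ a₁ : ℝ} :
    Gauge9RegSepTopStepR F N Sup M c B₃ B₃' a₀ a₁ ↔ Gauge9RegSepTopStepG F N Sup M (floorGuard F c) B₃ B₃' a₀ a₁ :=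
  Iff.rfl

/-- 34c's floor-carrying four-letter token IS the instance `Adm := floorGuard F c`. [cite: Balaban1985RegularSpaces, (1.3)–(1.6) p.77 (bookkeeping)] -/
theorem gauge9RegSepTopStepR10_iff_G_floorGuard {Sup : (ν : Stage7Numerics) → (K : ℕ) → (ℕ → Set (Site (F.P K) 0)) → Set (Site (F.P K) 0)} {M c : ℕ} {B₃ B₃' a₀ a₁ : ℝ} :
    Gauge9RegSepTopStepR10 F N Sup M c B₃ B₃' a₀ a₁ ↔ Gauge9RegSepTopStepR10G F N Sup M (floorGuard F c) B₃ B₃' a₀ a₁ :=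
  Iff.rfl

/-- Antitone in the ceilings `a₀ a₁`. [cite: Balaban1985Variational, Thm 1 (9) p.279 (bookkeeping)] -/
theorem Gauge9RegSepTopStepG.of_le {Sup : (ν : Stage7Numerics) → (K : ℕ) → (ℕ → Set (Site (F.P K) 0)) → Set (Site (F.P K) 0)} {M : ℕ} {Adm : StepGuard F} {B₃ B₃' a₀ a₀' a₁ a₁' : ℝ}
    (h : Gauge9RegSepTopStepG F N Sup M Adm B₃ B₃' a₀ a₁) (ha₀ : a₀' ≤ a₀) (ha₁ : a₁' ≤ a₁) : Gauge9RegSepTopStepG F N Sup M Adm B₃ B₃' a₀' a₁' :=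
  fun ν g K k s hsep hM₁ hadm hk ε₀ δ hδ hcomp hcomp' hε₀ =>
    h ν g K k s hsep hM₁ hadm hk ε₀ δ (fun n hn => ⟨(hδ n hn).1, (hδ n hn).2.1.trans ha₁, (hδ n hn).2.2⟩) hcomp hcomp' (hε₀.trans ha₀)

/-- ANTITONE IN THE GUARD. [cite: Balaban1985Variational, Thm 1 (9) p.279 (bookkeeping)] -/
theorem Gauge9RegSepTopStepG.of_imp {Sup : (ν : Stage7Numerics) → (K : ℕ) → (ℕ → Set (Site (F.P K) 0)) → Set (Site (F.P K) 0)} {M : ℕ} {Adm Adm' : StepGuard F} {B₃ B₃' a₀ a₁ : ℝ}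
    (h : Gauge9RegSepTopStepG F N Sup M Adm B₃ B₃' a₀ a₁) (himp : ∀ ν M g K k s, Adm' ν M g K k s → Adm ν M g K k s) :
    Gauge9RegSepTopStepG F N Sup M Adm' B₃ B₃' a₀ a₁ :=
  fun ν g K k s hsep hM₁ hadm' hk => h ν g K k s hsep hM₁ (himp ν M g K k s hadm') hk

/-- A floor-carrying (9)-token serves every guard implying its floor. [cite: Balaban1985RegularSpaces, (1.3)–(1.6) p.77 (bookkeeping)] -/
theorem Gauge9RegSepTopStepR.toG_of_imp_floor {Sup : (ν : Stage7Numerics) → (K : ℕ) → (ℕ → Set (Site (F.P K) 0)) → Set (Site (F.P K) 0)} {M c : ℕ} {Adm : StepGuard F} {B₃ B₃' a₀ a₁ : ℝ}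
    (h : Gauge9RegSepTopStepR F N Sup M c B₃ B₃' a₀ a₁) (himp : ∀ ν M g K k s, Adm ν M g K k s → c ≤ ν.M₁) : Gauge9RegSepTopStepG F N Sup M Adm B₃ B₃' a₀ a₁ :=
  (gauge9RegSepTopStepR_iff_G_floorGuard.1 h).of_imp himp

/-- A guarded (9)-token whose guard follows from a floor is floor-carrying. [cite: Balaban1985RegularSpaces, (1.3)–(1.6) p.77 (bookkeeping)] -/
theorem Gauge9RegSepTopStepG.toR_of_floor_imp {Sup : (ν : Stage7Numerics) → (K : ℕ) → (ℕ → Set (Site (F.P K) 0)) → Set (Site (F.P K) 0)} {M c : ℕ} {Adm : StepGuard F} {B₃ B₃' a₀ a₁ : ℝ}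
    (h : Gauge9RegSepTopStepG F N Sup M Adm B₃ B₃' a₀ a₁) (himp : ∀ ν M g K k s, c ≤ ν.M₁ → Adm ν M g K k s) : Gauge9RegSepTopStepR F N Sup M c B₃ B₃' a₀ a₁ :=
  gauge9RegSepTopStepR_iff_G_floorGuard.2 (h.of_imp himp)

/-- Antitone in the ceilings (four-letter token). [cite: Balaban1985Variational, Thm 1 (9)–(10) p.279 (bookkeeping)] -/
theorem Gauge9RegSepTopStepR10G.of_le {Sup : (ν : Stage7Numerics) → (K : ℕ) → (ℕ → Set (Site (F.P K) 0)) → Set (Site (F.P K) 0)} {M : ℕ} {Adm : StepGuard F} {B₃ B₃' a₀ a₀' a₁ a₁' : ℝ}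
    (h : Gauge9RegSepTopStepR10G F N Sup M Adm B₃ B₃' a₀ a₁) (ha₀ : a₀' ≤ a₀) (ha₁ : a₁' ≤ a₁) : Gauge9RegSepTopStepR10G F N Sup M Adm B₃ B₃' a₀' a₁' :=
  fun ν g K k s hsep hM₁ hadm hk ε₀ δ hδ hcomp hcomp' hε₀ =>
    h ν g K k s hsep hM₁ hadm hk ε₀ δ (fun n hn => ⟨(hδ n hn).1, (hδ n hn).2.1.trans ha₁, (hδ n hn).2.2⟩) hcomp hcomp' (hε₀.trans ha₀)

/-- Antitone in the guard (four-letter token). [cite: Balaban1985Variational, Thm 1 (9)–(10) p.279 (bookkeeping)] -/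
theorem Gauge9RegSepTopStepR10G.of_imp {Sup : (ν : Stage7Numerics) → (K : ℕ) → (ℕ → Set (Site (F.P K) 0)) → Set (Site (F.P K) 0)} {M : ℕ} {Adm Adm' : StepGuard F} {B₃ B₃' a₀ a₁ : ℝ}
    (h : Gauge9RegSepTopStepR10G F N Sup M Adm B₃ B₃' a₀ a₁) (himp : ∀ ν M g K k s, Adm' ν M g K k s → Adm ν M g K k s) :
    Gauge9RegSepTopStepR10G F N Sup M Adm' B₃ B₃' a₀ a₁ :=
  fun ν g K k s hsep hM₁ hadm' hk => h ν g K k s hsep hM₁ (himp ν M g K k s hadm') hk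

/-- 34c's floor-carrying four-letter token serves every guard implying its floor. [cite: Balaban1985RegularSpaces, (1.3)–(1.6) p.77 (bookkeeping)] -/
theorem Gauge9RegSepTopStepR10.toG_of_imp_floor {Sup : (ν : Stage7Numerics) → (K : ℕ) → (ℕ → Set (Site (F.P K) 0)) → Set (Site (F.P K) 0)} {M c : ℕ} {Adm : StepGuard F} {B₃ B₃' a₀ a₁ : ℝ}
    (h : Gauge9RegSepTopStepR10 F N Sup M c B₃ B₃' a₀ a₁) (himp : ∀ ν M g K k s, Adm ν M g K k s → c ≤ ν.M₁) :
    Gauge9RegSepTopStepR10G F N Sup M Adm B₃ B₃' a₀ a₁ :=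
  (gauge9RegSepTopStepR10_iff_G_floorGuard.1 h).of_imp himp

/-- NEW ⇒ OLD under any guard: forgetting the second-order letter (33b's `LocalGauge10On.toLocalGaugeOn`). [cite: Balaban1985Variational, (152) p.301 (bookkeeping)] -/
theorem Gauge9RegSepTopStepR10G.toG {Sup : (ν : Stage7Numerics) → (K : ℕ) → (ℕ → Set (Site (F.P K) 0)) → Set (Site (F.P K) 0)} {M : ℕ} {Adm : StepGuard F} {B₃ B₃' a₀ a₁ : ℝ}
    (h : Gauge9RegSepTopStepR10G F N Sup M Adm B₃ B₃' a₀ a₁) : Gauge9RegSepTopStepG F N Sup M Adm B₃ B₃' a₀ a₁ :=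
  fun ν g K k s hsep hM₁ hadm hk ε₀ δ hδ hcomp hcomp' hε₀ W h7 U h17 h19 hfib hcrit n hn1 hnk S hS hSN a ha hΩ =>
    (h ν g K k s hsep hM₁ hadm hk ε₀ δ hδ hcomp hcomp' hε₀ W h7 U h17 h19 hfib hcrit n hn1 hnk S hS hSN a ha hΩ).toLocalGaugeOn

end TokensG

/-! ## §2  The (9)-reductions from the GUARDED stub-1 fact -/

section ReductionsG

variable {F : T4Family} {N : ℕ} [NeZero N]

/-- ★ **THE (9)-REDUCTION WITH STUB 1 GUARDED**: `Prop8RegSepTopStepG Adm` and the (152) token at floor `c` give the three-letter (9)-token under the guard `Adm ⊓ floorGuard c`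
(module 48's `gauge9R_of_prop8TopStepR_of_gauge152R` with `hadm.1` feeding stub 1 and `hadm.2` the token's floor). [cite: Balaban1985Variational, Sect. F pp.300–305, Prop. 8 p.304, (152) p.301, Thm 1 (8)–(9) p.279] -/
theorem gauge9G_of_prop8TopStepG_of_gauge152R {Sup : (ν : Stage7Numerics) → (K : ℕ) → (ℕ → Set (Site (F.P K) 0)) → Set (Site (F.P K) 0)} {M c : ℕ} {Adm : StepGuard F} {B₃ B₉ a₀ a₀' a₁ : ℝ}
    (h8 : Prop8RegSepTopStepG F N Sup Adm B₃ a₀ a₁) (h152 : Gauge152OfClassTopStepR F N Sup M c B₉ a₀') (hB₃ : 0 < B₃) (ha : B₃ * a₁ ≤ a₀') :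
    Gauge9RegSepTopStepG F N Sup M (fun ν M g K k s => Adm ν M g K k s ∧ c ≤ ν.M₁) B₃ (B₉ * B₃) a₀ a₁ := by
  intro ν g K k s hsep hM₁ hadm hk ε₀ δ hδ hcomp hcomp' hε₀ W h7 U h17 h19 hfib hcrit n hn1 hnk S hS hSN a ha' hΩ
  obtain ⟨h8p, h8c⟩ := h8 ν M g K k s hsep hM₁ hadm.1 hk ε₀ δ hδ hcomp hcomp' hε₀ W h7 U h17 h19 hfib hcrit
  have hε : ∀ m, m ≤ k → 0 < B₃ * δ m ∧ B₃ * δ m ≤ a₀' := fun m hm =>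
    ⟨mul_pos hB₃ (hδ m hm).1, (mul_le_mul_of_nonneg_left (hδ m hm).2.1 hB₃.le).trans ha⟩
  have hc1 : ∀ m, m < k → B₃ * δ m ≤ 2 * (B₃ * δ (m + 1)) := fun m hm => by
    have := mul_le_mul_of_nonneg_left (hcomp m hm) hB₃.le; linarith
  have hc2 : ∀ m, m < k → B₃ * δ (m + 1) ≤ 2 * (B₃ * δ m) := fun m hm => by
    have := mul_le_mul_of_nonneg_left (hcomp' m hm) hB₃.le; linarith
  obtain ⟨u, A, hexp, hA, hgrad⟩ := h152 ν g K k s hsep hM₁ hadm.2 hk (fun m => B₃ * δ m) hε hc1 hc2 U h8p h8c n hn1 hnk S hS hSN a ha' hΩ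
  refine ⟨u, A, hexp, fun b hb => ?_, fun q hq => ?_⟩
  · calc ‖A b‖ < B₉ * (B₃ * δ n) := hA b hb
      _ = B₉ * B₃ * δ n := by ring
  · calc ‖grad ((F.P K).eta n) q.2.1 (fun y => A ⟨y, q.2.2⟩) q.1‖ < B₉ * (B₃ * δ n) := hgrad q hq
      _ = B₉ * B₃ * δ n := by ring

/-- ★ **THE (9)–(10)-REDUCTION WITH STUB 1 GUARDED** (four-letter token; module 48's `gauge9R10_of_prop8TopStepR_of_gauge152R10` with `hadm`). [cite: Balaban1985Variational, Sect. F pp.300–305, Prop. 8 p.304, (152) p.301, Thm 1 (8)–(10) p.279] -/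
theorem gauge9R10G_of_prop8TopStepG_of_gauge152R10 {Sup : (ν : Stage7Numerics) → (K : ℕ) → (ℕ → Set (Site (F.P K) 0)) → Set (Site (F.P K) 0)} {M c : ℕ} {Adm : StepGuard F} {B₃ B₉ a₀ a₀' a₁ : ℝ}
    (h8 : Prop8RegSepTopStepG F N Sup Adm B₃ a₀ a₁) (h152 : Gauge152OfClassTopStepR10 F N Sup M c B₉ a₀') (hB₃ : 0 < B₃) (ha : B₃ * a₁ ≤ a₀') :
    Gauge9RegSepTopStepR10G F N Sup M (fun ν M g K k s => Adm ν M g K k s ∧ c ≤ ν.M₁) B₃ (B₉ * B₃) a₀ a₁ := by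
  intro ν g K k s hsep hM₁ hadm hk ε₀ δ hδ hcomp hcomp' hε₀ W h7 U h17 h19 hfib hcrit n hn1 hnk S hS hSN a ha' hΩ
  obtain ⟨h8p, h8c⟩ := h8 ν M g K k s hsep hM₁ hadm.1 hk ε₀ δ hδ hcomp hcomp' hε₀ W h7 U h17 h19 hfib hcrit
  have hε : ∀ m, m ≤ k → 0 < B₃ * δ m ∧ B₃ * δ m ≤ a₀' := fun m hm =>
    ⟨mul_pos hB₃ (hδ m hm).1, (mul_le_mul_of_nonneg_left (hδ m hm).2.1 hB₃.le).trans ha⟩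
  have hc1 : ∀ m, m < k → B₃ * δ m ≤ 2 * (B₃ * δ (m + 1)) := fun m hm => by
    have := mul_le_mul_of_nonneg_left (hcomp m hm) hB₃.le; linarith
  have hc2 : ∀ m, m < k → B₃ * δ (m + 1) ≤ 2 * (B₃ * δ m) := fun m hm => by
    have := mul_le_mul_of_nonneg_left (hcomp' m hm) hB₃.le; linarith
  have h := h152 ν g K k s hsep hM₁ hadm.2 hk (fun m => B₃ * δ m) hε hc1 hc2 U h8p h8c n hn1 hnk S hS hSN a ha' hΩ
  rw [show B₉ * B₃ * δ n = B₉ * (B₃ * δ n) by ring]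
  exact h

/-- The (9)-reduction under ONE guard that implies the (152) token's floor. [cite: Balaban1985Variational, Sect. F pp.300–305, Thm 1 (8)–(9) p.279 (bookkeeping)] -/
theorem gauge9G_of_prop8TopStepG_of_gauge152R_of_imp {Sup : (ν : Stage7Numerics) → (K : ℕ) → (ℕ → Set (Site (F.P K) 0)) → Set (Site (F.P K) 0)} {M c : ℕ} {Adm : StepGuard F} {B₃ B₉ a₀ a₀' a₁ : ℝ}
    (h8 : Prop8RegSepTopStepG F N Sup Adm B₃ a₀ a₁) (h152 : Gauge152OfClassTopStepR F N Sup M c B₉ a₀') (hB₃ : 0 < B₃) (ha : B₃ * a₁ ≤ a₀')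
    (himp : ∀ ν M g K k s, Adm ν M g K k s → c ≤ ν.M₁) : Gauge9RegSepTopStepG F N Sup M Adm B₃ (B₉ * B₃) a₀ a₁ :=
  (gauge9G_of_prop8TopStepG_of_gauge152R h8 h152 hB₃ ha).of_imp fun ν M g K k s h => ⟨h, himp ν M g K k s h⟩

/-- The (9)–(10)-reduction under ONE guard that implies the (152) token's floor. [cite: Balaban1985Variational, Sect. F pp.300–305, Thm 1 (8)–(10) p.279 (bookkeeping)] -/
theorem gauge9R10G_of_prop8TopStepG_of_gauge152R10_of_imp {Sup : (ν : Stage7Numerics) → (K : ℕ) → (ℕ → Set (Site (F.P K) 0)) → Set (Site (F.P K) 0)} {M c : ℕ} {Adm : StepGuard F} {B₃ B₉ a₀ a₀' a₁ : ℝ}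
    (h8 : Prop8RegSepTopStepG F N Sup Adm B₃ a₀ a₁) (h152 : Gauge152OfClassTopStepR10 F N Sup M c B₉ a₀') (hB₃ : 0 < B₃) (ha : B₃ * a₁ ≤ a₀')
    (himp : ∀ ν M g K k s, Adm ν M g K k s → c ≤ ν.M₁) : Gauge9RegSepTopStepR10G F N Sup M Adm B₃ (B₉ * B₃) a₀ a₁ :=
  (gauge9R10G_of_prop8TopStepG_of_gauge152R10 h8 h152 hB₃ ha).of_imp fun ν M g K k s h => ⟨h, himp ν M g K k s h⟩

end ReductionsG

/-! ## §3  ★★ 36c's K0-road suppliers with stub 1 GUARDED (stub 2′'s bare `ρ₀ ≥ 1`, `ρ := ρ₀·L`) -/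

section PrintG

variable {F : T4Family} {N : ℕ} [NeZero N]

/-- ★★ **THE THREE-LETTER (9)-TOKEN FROM THE GUARDED TOP STEP ∧ [6] PROP. 6 ON PRINT'S CLASS** (`ρ₀ ≥ 1`): guard `Adm ⊓ floorGuard ((11·4 + 4·(ρ₀L))·L)`, constants `b9OfP·B₃`,
`a0OfP` unchanged — 36c's `gauge9RP_of_prop8TopStep_of_prop6P_of_one_le` with stub 1 guarded. [cite: Balaban1985Variational, Thm 1 (8)–(9) p.279, Prop. 8 p.304; Balaban1985RegularSpaces, Prop. 6 p.99, p.98] -/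
theorem gauge9GP_of_prop8TopStepG_of_prop6P_of_one_le {Adm : StepGuard F} {B₃ a₀ a₁ B₁ c₁ : ℝ}
    (h8 : Prop8RegSepTopStepG F N (fun ν K Ω => suppDomOfRecord F ν K Ω) Adm B₃ a₀ a₁) (hB₁ : 0 ≤ B₁) (hc₁ : 0 < c₁) {ρ₀ : ℕ} (hρ₀ : 1 ≤ ρ₀)
    (hP6 : letI : CStarAlgebra (MatA N) := {}; B8.Prop6Printed 4 (F.L : ℝ) B₁ c₁ (fun i : ZdIdx 4 F.L => zdCubP (MatA N) F.L ρ₀ i)) (M : ℕ)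
    (hB₃ : 0 < B₃) (ha : B₃ * a₁ ≤ a0OfP F N M (ρ₀ * F.L) B₁ c₁) :
    Gauge9RegSepTopStepG F N (fun ν K Ω => suppDomOfRecord F ν K Ω) M
      (fun ν M g K k s => Adm ν M g K k s ∧ (11 * 4 + 4 * (ρ₀ * F.L)) * F.L ≤ ν.M₁) B₃ (b9OfP F M (ρ₀ * F.L) B₁ * B₃) a₀ a₁ :=
  gauge9G_of_prop8TopStepG_of_gauge152R h8 (gauge152RP_of_prop6_of_one_le hB₁ hc₁ hρ₀ hP6 M) hB₃ ha

/-- ★★ **THE FOUR-LETTER (9)-TOKEN FROM THE GUARDED TOP STEP ∧ PROP. 6 ON PRINT'S CLASS** (`ρ₀ ≥ 1`): guard `Adm ⊓ floorGuard ((11·4 + 4·(ρ₀L))·L)`.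
[cite: Balaban1985Variational, Thm 1 (8)–(10) p.279, Prop. 8 p.304; Balaban1985RegularSpaces, Prop. 6 p.99, p.98] -/
theorem gauge9R10GP_of_prop8TopStepG_of_prop6P_of_one_le {Adm : StepGuard F} {B₃ a₀ a₁ B₁ c₁ : ℝ}
    (h8 : Prop8RegSepTopStepG F N (fun ν K Ω => suppDomOfRecord F ν K Ω) Adm B₃ a₀ a₁) (hB₁ : 0 ≤ B₁) (hc₁ : 0 < c₁) {ρ₀ : ℕ} (hρ₀ : 1 ≤ ρ₀)
    (hP6 : letI : CStarAlgebra (MatA N) := {}; B8.Prop6Printed 4 (F.L : ℝ) B₁ c₁ (fun i : ZdIdx 4 F.L => zdCubP (MatA N) F.L ρ₀ i)) (M : ℕ)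
    (hB₃ : 0 < B₃) (ha : B₃ * a₁ ≤ a0OfP F N M (ρ₀ * F.L) B₁ c₁) :
    Gauge9RegSepTopStepR10G F N (fun ν K Ω => suppDomOfRecord F ν K Ω) M
      (fun ν M g K k s => Adm ν M g K k s ∧ (11 * 4 + 4 * (ρ₀ * F.L)) * F.L ≤ ν.M₁) B₃ (b9OfP F M (ρ₀ * F.L) B₁ * B₃) a₀ a₁ :=
  gauge9R10G_of_prop8TopStepG_of_gauge152R10 h8 (gauge152R10P_of_prop6_of_one_le hB₁ hc₁ hρ₀ hP6 M) hB₃ ha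

/-- Sanity: with the floor guard `floorGuard F c₈` for `Adm`, §3's token IS module 48's at floor `max c₈ ((11·4 + 4·(ρ₀L))·L)` (the conjunction of two floors is the floor at the max).
[cite: Balaban1985Variational, Thm 1 (8)–(9) p.279 (bookkeeping)] -/
theorem gauge9RP_of_prop8TopStepG_floorGuard_of_prop6P_of_one_le {c₈ : ℕ} {B₃ a₀ a₁ B₁ c₁ : ℝ}
    (h8 : Prop8RegSepTopStepG F N (fun ν K Ω => suppDomOfRecord F ν K Ω) (floorGuard F c₈) B₃ a₀ a₁) (hB₁ : 0 ≤ B₁) (hc₁ : 0 < c₁) {ρ₀ : ℕ}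
    (hρ₀ : 1 ≤ ρ₀) (hP6 : letI : CStarAlgebra (MatA N) := {}; B8.Prop6Printed 4 (F.L : ℝ) B₁ c₁ (fun i : ZdIdx 4 F.L => zdCubP (MatA N) F.L ρ₀ i)) (M : ℕ)
    (hB₃ : 0 < B₃) (ha : B₃ * a₁ ≤ a0OfP F N M (ρ₀ * F.L) B₁ c₁) :
    Gauge9RegSepTopStepR F N (fun ν K Ω => suppDomOfRecord F ν K Ω) M (max c₈ ((11 * 4 + 4 * (ρ₀ * F.L)) * F.L)) B₃
      (b9OfP F M (ρ₀ * F.L) B₁ * B₃) a₀ a₁ :=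
  (gauge9GP_of_prop8TopStepG_of_prop6P_of_one_le h8 hB₁ hc₁ hρ₀ hP6 M hB₃ ha).toR_of_floor_imp fun _ _ _ _ _ _ h =>
    ⟨(le_max_left _ _).trans h, (le_max_right _ _).trans h⟩

end PrintG

end Literature.MathematicalPhysics.QuantumFieldTheory.Balaban1983to89.Node00

end
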